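import Summits.HodgeConjecture.HodgeCM.Model.SupplyInstance_1
import Summits.HodgeConjecture.HodgeCM.Model.HypCensus.ArchDatumBlockCM
import Literature.NumberTheory.GelbartRogawski1991.DoubledWeilRepresentationArchVacuumUndoubling
import Literature.NumberTheory.Automorphic.AdelicTensorStripping
import Literature.NumberTheory.Weil1964.ArchFollandCompactKType
import HarnessLib

/-!
# COR-CM, item (vi) transposition: the package's Gaussian test functions are the Literature pure tensors `G_𝕍 ⊗ f`
# (two junctions for the central-type reading of the index; pin-3 gen 9, 2026-08-23)

Topic: `Summits/HodgeConjecture/CorCM/B01/Transposition` (blanket `Transposition/Item6*`, pin-3 ∕ own-htheta lineage); namespace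
`Summit.HodgeConjecture.CorCM.Transposition.GaussianTestFunction`.  KERNEL ONLY: two proved theorems, 0 definitions, 0 records,
0 named facts, 0 `sorry`.  Count-neutral: no binder of `BINDER-OWNERS.md` is touched; HC_CM is NOT proved here or anywhere in the tree.

The Literature leaves `GelbartRogawski1991/DoubledWeilRepresentationArchVacuumUndoubling` (✔ p349634) and
`Liu2021/Def411WeilCarriersCentralTypeGaussian` (✔ p350403) compute the archimedean CENTRAL TYPE of the splitting attached to a
character on the pure tensors `G_𝕍 ⊗ f`, `G_𝕍 = gaussianV …` the Folland–Fock vacuum of the Literature frame `frameV`, `f` any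
finite Schwartz–Bruhat function.  The ported package reads central types (`LiuIndex.HasCentralTypeAt`, port layer L69) on the
thin-coset TEST FUNCTIONS `testFun L⁺ (Fin 3) (gaussianAt V a) x₀ N` of ITS Gaussian `gaussianAt V a := follandFock (cmBigFrame … ι₁) 1`
(binder-2's canonical scaled frame at `ι₁`).  This file proves the two junctions, both already available below L69:

* (J2) `testFun_eq_piSchwartzBruhatEquiv_tmul`: `testFun K J Φ x₀ N = Φ ⊗ 𝟙_{(N𝒪̂)^J}(−x₀ + ·)` — the package's test function IS a
  pure tensor (tree `thinCosetTestFunₗ_eq_tmul`);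
* (J1) `follandFock_cmBigFrame_one_eq_gaussianV`: `follandFock (cmBigFrame … ι₁) 1 = gaussianV …` for EVERY diagonal CM pair datum
  `(dV, dW)` and every `ι₁` — the canonical frame's scales `√|x_V i| · √|x_W j|` and the Literature frame's `√|σ_v(d_V d_W)/Im σ_{w(v)}(δ)|`
  have the same squares (the sign convention `cmSignConv ι₁` cancels), and both vectors are `2^{nr/4} e^{−π Σ (scale · x)²}`.

With these, `LiuIndex.HasCentralTypeAt V a (chiSplittingLine χ …) (centralType τ)` (port-gated L69) is a two-line transport of
`pairRep_chiSplittingLine_center_gaussianV_tmul_cm`.  References: G. B. Folland, *Harmonic Analysis in Phase Space* (1989), §1.7,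
§4.2 Prop. (4.39) [Folland1989]; A. Weil, Acta Math. 111 (1964), n° 29, Chap. III n° 37–38 [Weil1964].  Provenance: pub-hodgecm2
(COR-CM) cell, seat pin-3 (gen 9), X3-Char item (E) transport.
-/

set_option autoImplicit false

noncomputable section

namespace Summit.HodgeConjecture.CorCM.Transposition.GaussianTestFunction

open NumberField NumberField.InfinitePlace NumberField.mixedEmbedding IsDedekindDomain
open scoped Matrix SchwartzMap Classical TensorProduct
open Literature.NumberTheory.Automorphic Literature.NumberTheory.Automorphic.UnitaryGroup Literature.NumberTheory.Weil1964
open Literature.NumberTheory.GelbartRogawski1991 Literature.NumberTheory.GelbartRogawski1991.UnitaryDualPair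
open Literature.NumberTheory.GelbartRogawski1991.GRConstruction
open Literature.Analysis.SegalBargmann
open HodgeCM.Model
open HodgeCM.Model.SupplyInstance (testFun finEmb coe_testFun)

section TestFunction

variable (K : Type) [Field K] [NumberField K] (J : Type) [Fintype J]

/-- **(J2) the thin-coset test function is a pure tensor**: `φ_N(Φ_∞) = Φ_∞ ⊗ 𝟙_{(N𝒪̂)^J}(−x₀ + ·)` in `𝒮(𝔸_K^J)` (the package's
`testFun` is the tree's `thinCosetTestFunₗ` at `(finEmb x₀, (N))`; tree `thinCosetTestFunₗ_eq_tmul`).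
[cite: Weil1964, n° 29 (standard functions are sums of products of local ones), Chap. III n° 37–38 pp. 188–190] -/
theorem testFun_eq_piSchwartzBruhatEquiv_tmul (Φ : 𝓢((J → mixedSpace K), ℂ)) (x₀ : J → K) (N : ℕ) :
    testFun K J Φ x₀ N =
      piSchwartzBruhatEquiv K J (Φ ⊗ₜ finTranslateSB K J (-finEmb K J x₀)
        (indicatorSB K J (piLevelIdeal K J (Ideal.span {(N : 𝓞 K)})) (isOpen_piLevelIdeal K _)
          (isCompact_piLevelIdeal K J _))) :=
  (show testFun K J Φ x₀ N = thinCosetTestFunₗ (K := K) (ι := J) (finEmb K J x₀) (Ideal.span {(N : 𝓞 K)}) Φ from rfl).trans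
    (thinCosetTestFunₗ_eq_tmul _ _ Φ)

end TestFunction

section Gaussian

variable (L : Type) [Field L] [NumberField L] [IsCMField L] {N M n : ℕ} (e : Fin N × Fin M ≃ Fin n)
  (dV : Fin N → L) (hdV : ∀ i, IsCMField.complexConj L (dV i) = dV i) (hdV0 : ∀ i, dV i ≠ 0)
  (dW : Fin M → L) (hdW : ∀ i, IsCMField.complexConj L (dW i) = dW i) (hdW0 : ∀ i, dW i ≠ 0) (ι₁ : L →+* ℂ)

/-- **(J1) the canonical-frame Gaussian of the pin IS the Literature Gaussian of the pair**:
`follandFock (cmBigFrame … ι₁) 1 = gaussianV …` — both are `2^{nr/4} exp(−π Σ_{k,v} |σ_v(d_V d_W)/Im σ_{w(v)}(δ)| x_{k,v}²)`; the sign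
convention `cmSignConv ι₁` of the canonical frame cancels between the `V`- and `W`-scales. [cite: Folland1989, §1.7, §4.2 Prop. (4.39)] -/
theorem follandFock_cmBigFrame_one_eq_gaussianV :
    follandFock (HypCensus.cmBigFrame L e dV hdV hdV0 dW hdW hdW0 ι₁) 1 = gaussianV L e dV hdV hdV0 dW hdW hdW0 := by
  ext x
  simp only [follandFock, gaussianV, follandHermite, schwartzTransport_symm_apply, binvPi, binv_one, hermiteSchwartzPi_apply,
    hermitePi_apply, herm_zero, hermiteFun, vac, MvPolynomial.eval_C, gauss]
  congr 3
  refine Finset.sum_congr rfl fun k _ => ?_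
  obtain ⟨k, v⟩ := k
  -- the squared scales agree: `(√|x_V i| √|x_W j|)² = |σ_v(dV i dW j) / Im σ_{w(v)}(δ)|`
  simp only [scaledFrame_apply, placeScale, pairScale, Complex.ofReal_mul, mul_pow, ← Complex.ofReal_pow]
  congr 2
  have h1 : HypCensus.cmDV L dV hdV ι₁ v (e.symm k).1 ^ 2 * HypCensus.cmDW L dV dW hdW ι₁ v (e.symm k).2 ^ 2 =
      sqrtAbs (signVec (cmPlaceOver L) (cmGramEntry L e dV hdV dW hdW) (imagUnit L) v) k ^ 2 := by
    simp only [HypCensus.cmDV, HypCensus.cmDW, HypCensus.cmXV, HypCensus.cmXW, HypCensus.cmCW, sqrtAbs, signVec, placeSignVec, deltaIm,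
      Real.sq_sqrt (abs_nonneg _), ← abs_mul]
    congr 1
    have hc := cmSignConv_ne_zero L dV ι₁ v
    rw [show embedding_of_isReal v.2 (cmGramEntry L e dV hdV dW hdW k) =
        embedding_of_isReal v.2 (cmRealVec L dV hdV (e.symm k).1) * embedding_of_isReal v.2 (cmRealVec L dW hdW (e.symm k).2) from by
      rw [← map_mul]; rfl]
    field_simp
  rw [← Complex.ofReal_mul, h1]

end Gaussian

end Summit.HodgeConjecture.CorCM.Transposition.GaussianTestFunction

end
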